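import Literature.AlgebraicGeometry.Resolution.QuasiExcellentCurveDelta
import Literature.AlgebraicGeometry.Resolution.RegularLocusDense
import Literature.AlgebraicGeometry.Resolution.AlterationsCurves
import Literature.AlgebraicGeometry.Resolution.QuasiExcellentField
import Literature.AlgebraicGeometry.Resolution.GeneralLU
import Literature.AlgebraicGeometry.Resolution.GeneralLUProofs
import Literature.AlgebraicGeometry.Resolution.ProjectiveSpaceRegular
import Literature.AlgebraicGeometry.Resolution.ResolutionGlue
import Literature.AlgebraicGeometry.Motives.Varieties
import Literature.AlgebraicGeometry.Motives.VarietiesDimensionProofs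
import Literature.AlgebraicGeometry.Motives.VarietiesProperProofs
import Literature.AlgebraicGeometry.Motives.VarietiesProjectiveSpaceProofs
import Literature.Topology.KrullDimensionDrop
import Mathlib.Topology.KrullDimension
import Mathlib.AlgebraicGeometry.Morphisms.ClosedImmersion
import HarnessLib

/-!
# Crux `EquisingularLift` (stmt-ResolutionOfSingularities-15660), line `strata-split`:
# stub `stub_singFinite_of_le_two`

The `n ≤ 2` vacuity ingredient of child 1 of the strata split: an integral closed subscheme
`H ⊆ ℙⁿ_k` (`k` a field, `n ≤ 2`) has only FINITELY many points with non-regular local ring.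

Proof. `H` is of finite type over the field `k` through `ι ≫ (ℙⁿ_k → Spec k)`, hence Noetherian
(`Scheme.isNoetherian_of_finiteType_over_field`) and quasi-excellent
(`Scheme.isQuasiExcellent_of_locallyOfFiniteType_of_isQuasiExcellentRing` with the DISCHARGED
`Stacks07QU_holds` and `isQuasiExcellentRing_of_field`). If `dim H ≤ 1`, the non-regular locus is a
closed (`Scheme.isOpen_regularLocus_of_isQuasiExcellent`) proper (the generic point is regular,
`genericPoint_mem_regularLocus`) subset of an irreducible Noetherian space of dimension `≤ 1`, hence
finite (`Set.finite_and_isClosed_singleton_of_dim_le_one`). Otherwise `dim H ≥ 2`; since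
`dim ℙⁿ_k = n ≤ 2` (`topologicalKrullDim_eq_of_smoothOfRelativeDimension`) and a proper closed subset
of the irreducible `ℙⁿ_k` has dimension `< n` (`Literature.Topology.topologicalKrullDim_lt_of_isClosed_ssubset`),
the closed immersion `ι` is surjective, hence an isomorphism onto the reduced `ℙⁿ_k`
(`isIso_of_isClosedImmersion_of_surjective`), and `ℙⁿ_k` is regular (`isRegular_projectiveSpace`):
there are no non-regular points at all.
-/

set_option linter.dupNamespace false -- mandated namespace `Summit.<Summit>.<Problem>` of this single-conjunct summit

noncomputable section

open CategoryTheory AlgebraicGeometry TopologicalSpace Topology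
open Literature.AlgebraicGeometry.Resolution Literature.AlgebraicGeometry.Motives

universe u

namespace Summit.ResolutionOfSingularities.ResolutionOfSingularities.Cruxes.EquisingularLift.StrataSplit

/-- On an integral Noetherian quasi-excellent scheme of dimension `≤ 1` the non-regular locus is a
finite set of closed points (extracted from the proof of
`Literature.AlgebraicGeometry.Resolution.finite_support_pointDelta`). [folklore] -/
theorem finite_compl_regularLocus_of_dim_le_one {X : Scheme.{u}} [IsIntegral X] [IsNoetherian X]
    (hX : Scheme.IsQuasiExcellent X) (hdim : topologicalKrullDim X ≤ 1) :
    (Scheme.regularLocus X)ᶜ.Finite ∧ ∀ x ∈ (Scheme.regularLocus X)ᶜ, IsClosed ({x} : Set X) := by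
  have hclosed : IsClosed (Scheme.regularLocus X)ᶜ :=
    (Scheme.isOpen_regularLocus_of_isQuasiExcellent hX).isClosed_compl
  have hne : (Scheme.regularLocus X)ᶜ ≠ Set.univ := by
    intro h
    have : genericPoint X ∈ (Scheme.regularLocus X)ᶜ := h ▸ Set.mem_univ _
    exact this (genericPoint_mem_regularLocus X)
  exact Set.finite_and_isClosed_singleton_of_dim_le_one hdim hclosed hne

/-- Pointwise form: on an integral Noetherian quasi-excellent scheme of dimension `≤ 1` the set of
points with non-regular stalk is finite. [folklore] -/
theorem finite_setOf_not_isRegularLocalRing_of_dim_le_one {X : Scheme.{u}} [IsIntegral X]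
    [IsNoetherian X] (hX : Scheme.IsQuasiExcellent X) (hdim : topologicalKrullDim X ≤ 1) :
    {x : X | ¬ IsRegularLocalRing (X.presheaf.stalk x)}.Finite :=
  (finite_compl_regularLocus_of_dim_le_one hX hdim).1

/-- `d < 2 → d ≤ 1` in `WithBot ℕ∞`. [folklore] -/
theorem withBotENat_le_one_of_lt_two {d : WithBot ℕ∞} (h : d < (2 : ℕ)) : d ≤ 1 := by
  induction d using WithBot.recBotCoe with
  | bot => exact bot_le
  | coe e =>
    have h' : e < 2 := by
      have : (e : WithBot ℕ∞) < ((2 : ℕ∞) : WithBot ℕ∞) := by simpa using h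
      exact WithBot.coe_lt_coe.mp this
    have h1 : e ≤ 1 := by
      have h12 : (2 : ℕ∞) = 1 + 1 := by norm_num
      rw [h12] at h'
      exact Order.le_of_lt_add_one h'
    exact_mod_cast h1

/-- A closed subscheme `H ↪ ℙⁿ_k` of projective space over a field is Noetherian and
quasi-excellent, being of finite type over the quasi-excellent field `k` (Stacks 07QU, discharged in
the tree as `Stacks07QU_holds`). [folklore] -/
theorem isNoetherian_and_isQuasiExcellent_of_isClosedImmersion_projectiveSpace {k : Type u} [Field k]
    (n : ℕ) {H : Scheme.{u}} (ι : H ⟶ (projectiveSpace n k).left) [IsClosedImmersion ι] :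
    IsNoetherian H ∧ Scheme.IsQuasiExcellent H := by
  haveI : IsProper (projectiveSpace n k).hom := isProper_projectiveSpace n k
  let f : H ⟶ Spec (.of k) := ι ≫ (projectiveSpace n k).hom
  haveI : LocallyOfFiniteType f := inferInstance
  haveI : QuasiCompact f := inferInstance
  exact ⟨Scheme.isNoetherian_of_finiteType_over_field f,
    Scheme.isQuasiExcellent_of_locallyOfFiniteType_of_isQuasiExcellentRing Stacks07QU_holds
      (isQuasiExcellentRing_of_field k) f⟩

/-- A closed immersion `ι : H ↪ ℙⁿ_k` from a scheme of topological Krull dimension NOT `≤ 1` into a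
projective space of dimension `n ≤ 2` over a field is an isomorphism: `dim ℙⁿ_k = n`, a proper closed
subset of the irreducible `ℙⁿ_k` has dimension `< n ≤ 2`, so `ι` is surjective, and a surjective
closed immersion into a reduced scheme is an isomorphism. [folklore] -/
theorem isIso_of_isClosedImmersion_projectiveSpace_of_not_dim_le_one {k : Type u} [Field k] {n : ℕ}
    {H : Scheme.{u}} (ι : H ⟶ (projectiveSpace n k).left) [IsClosedImmersion ι] (hn : n ≤ 2)
    (hdim : ¬ topologicalKrullDim H ≤ 1) : IsIso ι := by
  haveI hint : IsIntegral (projectiveSpace n k).left := isIntegral_projectiveSpace n k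
  haveI : SmoothOfRelativeDimension n (projectiveSpace n k).hom :=
    (isSmoothProjective_projectiveSpace_holds k n).smoothOfRelativeDimension
  have hdimP : topologicalKrullDim ↥(projectiveSpace n k).left = (n : ℕ) :=
    topologicalKrullDim_eq_of_smoothOfRelativeDimension (projectiveSpace n k).hom n
  -- the image of `ι` is all of `ℙⁿ_k`
  have hcl : IsClosed (Set.range ι.base) := ι.isClosedEmbedding.isClosed_range
  have hrange : Set.range ι.base = Set.univ := by
    by_contra hne
    apply hdim
    have hP : topologicalKrullDim ↥(projectiveSpace n k).left < (2 + 1 : ℕ) := by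
      rw [hdimP]
      exact_mod_cast Nat.lt_succ_of_le hn
    have hlt := Literature.Topology.topologicalKrullDim_lt_of_isClosed_ssubset hcl hne 2 hP
    have heq : topologicalKrullDim H = topologicalKrullDim (Set.range ι.base) :=
      IsHomeomorph.topologicalKrullDim_eq _ ι.isClosedEmbedding.isEmbedding.toHomeomorph.isHomeomorph
    exact withBotENat_le_one_of_lt_two (heq ▸ hlt)
  haveI : Surjective ι := ⟨Set.range_eq_univ.mp hrange⟩
  exact isIso_of_isClosedImmersion_of_surjective ι

/-- **STUB `stub_singFinite_of_le_two`** (line `strata-split`, the `n ≤ 2` vacuity of child 1): an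
integral closed subscheme `H ⊆ ℙⁿ_k` with `n ≤ 2` (a point, `ℙ¹`, a plane curve, or `ℙⁿ` itself) has
only FINITELY many points with non-regular stalk. If `dim H ≤ 1` this is
`finite_setOf_not_isRegularLocalRing_of_dim_le_one` (`H` is Noetherian and quasi-excellent, of finite
type over a field); otherwise `ι` is an isomorphism onto the regular scheme `ℙⁿ_k`
(`isIso_of_isClosedImmersion_projectiveSpace_of_not_dim_le_one`, `isRegular_projectiveSpace`) and
there are no non-regular points. The characteristic, algebraic closedness and local principality
hypotheses are not used. [folklore] -/
theorem stub_singFinite_of_le_two : ∀ p : ℕ, p.Prime → ∀ (k : Type) [Field k] [CharP k p] [IsAlgClosed k] (n : ℕ) (H : AlgebraicGeometry.Scheme.{0}) (ι : H ⟶ (Literature.AlgebraicGeometry.Motives.projectiveSpace n k).left), AlgebraicGeometry.IsClosedImmersion ι → AlgebraicGeometry.IsIntegral H → (∀ y : (Literature.AlgebraicGeometry.Motives.projectiveSpace n k).left, ∃ U : (Literature.AlgebraicGeometry.Motives.projectiveSpace n k).left.affineOpens, y ∈ (U : (Literature.AlgebraicGeometry.Motives.projectiveSpace n k).left.Opens)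 ∧ (ι.ker.ideal U).IsPrincipal) → n ≤ 2 → {x : H | ¬ IsRegularLocalRing (H.presheaf.stalk x)}.Finite := by
  intro _ _ k _ _ _ n H ι hι hH _ hn
  obtain ⟨hN, hqe⟩ := isNoetherian_and_isQuasiExcellent_of_isClosedImmersion_projectiveSpace n ι
  by_cases hdim : topologicalKrullDim H ≤ 1
  · exact finite_setOf_not_isRegularLocalRing_of_dim_le_one hqe hdim
  · haveI : IsIso ι := isIso_of_isClosedImmersion_projectiveSpace_of_not_dim_le_one ι hn hdim
    have hreg : Scheme.IsRegular H := Scheme.IsRegular.of_iso (inv ι) (isRegular_projectiveSpace n k)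
    exact Set.finite_empty.subset fun x hx => (hx (hreg x)).elim

end Summit.ResolutionOfSingularities.ResolutionOfSingularities.Cruxes.EquisingularLift.StrataSplit

end
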